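import Literature.NumberTheory.EllipticCurves.DescendedFrobeniusMatrix
import Literature.IUT.LogVolume.WildCubicUnitLog
import Summits.BirchSwinnertonDyer.Rank1Residual.O5.FlexTangentNormalFormThree
import Summits.BirchSwinnertonDyer.BirchSwinnertonDyer.Theorems.CyclotomicUntwistGNineToolkit
import HarnessLib

/-!
# The ring `𝓞 = integralClosure ℤ₃ ℚ₃(ζ₉)` of the LOCAL currency of `DescendedFrobeniusMatrix`, I: `ζ₉ ∈ 𝓞`,
# the explicit unit `θ⁻¹ ∈ ℤ[ζ₉]`, `3 = −(1 − ζ₉)⁶θ⁻¹`, `1/3 ∉ 𝓞`, and the one-step residue lemma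

Cell `pub/bsd-wall` (D-0145 line `route-BirchSwinnertonDyer-CyclotomicUntwist`), seat `bsd-line-cycu-p4` (gen 7),
helper toward K1 `PSRankOneLowerHalfAtThree` (stmt-BirchSwinnertonDyer-21580) / K2 (21581), registered line `dfrob`
(`Cruxes/PSRankOneLowerHalfAtThree/Lines/dfrob.lean`, lead cycu-p1 g5), stub **S2 `stub_descendedFrobenius`** — its
LOCAL half. THEOREMS ONLY (no definition, no named fact, no `sorry`); BSD is not proved by this file and no crux is.
Sequel: `CyclotomicUntwistNineIntegersResidueMap.lean` (`𝓞/(1 − ζ₉)𝓞 = 𝔽₃` and the reduction map `ρ : 𝓞 →+* ZMod 3`).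

## What and why

The Literature predicate `WeierstrassCurve.IsDescendedFrobeniusMatrix` (p623342) and its named existence fact
`WeierstrassCurve.isDescendedFrobeniusMatrix_exists` live over `K = KNine = CyclotomicField 9 ℚ_[3]` and
`𝓞 = ONine = integralClosure ℤ_[3] K`: a `NineGoodModel` is a Weierstrass equation over `𝓞` with unit discriminant,
and `NineGoodModel.specialFibreTrace ρ` reads its special fibre along ANY ring map `ρ : 𝓞 →+* ZMod 3`. Mathlib has
no ring-of-integers theory for `ℚ₃(ζ₉)` (no `𝓞 = ℤ₃[ζ₉]`, no valuation on `K`, no residue field), so consuming the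
named fact needs, besides explicit good models (sequel files `…NineGoodModelLeafII/LeafIV`), the elementary facts:

* §1 (any field, `ζ` a primitive ninth root of unity): **`θ · θ⁻¹ = 1` with `θ⁻¹ = −10 − 11ζ − 7ζ² − 10ζ³ − 4ζ⁴ + 4ζ⁵
  ∈ ℤ[ζ]`** for the unit `θ = 1 − 3ϖ + 6ϖ² − 7ϖ³ + 5ϖ⁴ − 2ϖ⁵`, `ϖ = 1 − ζ`, `ϖ⁶ = −3θ` of `GNine.varpi_pow_six`
  (`theta_mul_thetaInv`), hence **`3 = −(1 − ζ)⁶ · θ⁻¹`** (`three_eq_neg_pow_six_mul_thetaInv`);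
* §2 memberships: `ζ₉ ∈ 𝓞`, `ℤ[ζ₉] ⊆ 𝓞` (`aeval_zeta_mem`), `θ, θ⁻¹, 1 − ζ₉ ∈ 𝓞`, `3`-adic integers `∈ 𝓞`, and the
  `norm_cast` convenience `coe_ofNat`;
* §3 **`1/3 ∉ 𝓞`** (`ℤ₃` integrally closed, `‖1/3‖₃ = 3`) and **`(1 − ζ₉)·y ≠ 1` for `y ∈ 𝓞`**;
* §4 (with `FlexTangent.norm_div_three_le_one` and `WildCubic.exists_residue` reused by import) the ONE-STEP residue lemma `norm_lt_one_of_residueFree`: for `x ∈ 𝓞` with no integer `a` such that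
  `x − a ∈ (1 − ζ₉)𝓞`, a relation `c₀ + c₁x ∈ (1 − ζ₉)𝓞` with `c₀, c₁ ∈ ℤ₃` forces `c₀, c₁ ∈ 3ℤ₃` — the engine of
  the sequel's proof that such an `x` does not exist (`𝓞/(1 − ζ₉)𝓞 = 𝔽₃`).

References: L. C. Washington, *Introduction to Cyclotomic Fields*, GTM 83, Lemma 1.4, Prop. 2.8 [Washington1997];
J.-P. Serre, *Local Fields*, GTM 67, I §4, II §3 [SerreLocalFields1979]; F. Q. Gouvêa, *p-adic Numbers*, §5
[Gouvea1993PadicNumbers].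
-/

noncomputable section

open scoped Polynomial

open Polynomial IsCyclotomicExtension Literature.NumberTheory.EllipticCurves.DescendedFrobenius
  Summit.BirchSwinnertonDyer.BirchSwinnertonDyer.Theorems Summit.BirchSwinnertonDyer.Rank1Residual.O5

-- single-conjunct summit: `Summit.BirchSwinnertonDyer.BirchSwinnertonDyer.…` repeats the name by design
set_option linter.dupNamespace false
set_option autoImplicit false

namespace Summit.BirchSwinnertonDyer.BirchSwinnertonDyer.Theorems.NineIntegers

/-! ### §1 Generic algebra of `ζ₉`: the unit `θ` and its explicit inverse in `ℤ[ζ₉]` -/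

section Generic

variable {K : Type*} [Field K] {ζ : K}

/-- **`θ⁻¹ ∈ ℤ[ζ₉]` explicitly.** With `ϖ = 1 − ζ` and `θ = 1 − 3ϖ + 6ϖ² − 7ϖ³ + 5ϖ⁴ − 2ϖ⁵` (so `ϖ⁶ = −3θ`,
`GNine.varpi_pow_six`), one has `θ · (−10 − 11ζ − 7ζ² − 10ζ³ − 4ζ⁴ + 4ζ⁵) = 1`: the cyclotomic unit
`θ = −(1 − ζ₉)⁶/3` is inverted inside `ℤ[ζ₉]` (Washington, *Cyclotomic Fields*, Lemma 1.4 / Prop. 2.8; the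
inverse found by linear algebra modulo `Φ₉` and certified by `linear_combination`). [folklore] -/
theorem theta_mul_thetaInv (hζ : IsPrimitiveRoot ζ 9) :
    (1 - 3 * (1 - ζ) + 6 * (1 - ζ) ^ 2 - 7 * (1 - ζ) ^ 3 + 5 * (1 - ζ) ^ 4 - 2 * (1 - ζ) ^ 5) *
      (-10 - 11 * ζ - 7 * ζ ^ 2 - 10 * ζ ^ 3 - 4 * ζ ^ 4 + 4 * ζ ^ 5) = 1 := by
  linear_combination (-1 - 20 * ζ + 28 * ζ ^ 2 - 28 * ζ ^ 3 + 8 * ζ ^ 4) * GNine.zeta_rel hζ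

/-- **`3 = −(1 − ζ₉)⁶ · θ⁻¹`**: the prime `3` is the sixth power of the uniformizer `1 − ζ₉` times an explicit unit
of `ℤ[ζ₉]` (total ramification of `3` in `ℚ(ζ₉)`/`ℚ₃(ζ₉)`, Washington Lemma 1.4). [folklore] -/
theorem three_eq_neg_pow_six_mul_thetaInv (hζ : IsPrimitiveRoot ζ 9) :
    (3 : K) = -((1 - ζ) ^ 6 * (-10 - 11 * ζ - 7 * ζ ^ 2 - 10 * ζ ^ 3 - 4 * ζ ^ 4 + 4 * ζ ^ 5)) := by
  have h6 := GNine.varpi_pow_six hζ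
  have hθ := theta_mul_thetaInv hζ
  linear_combination (-10 - 11 * ζ - 7 * ζ ^ 2 - 10 * ζ ^ 3 - 4 * ζ ^ 4 + 4 * ζ ^ 5) * h6 - (3 : K) * hθ

/-- `θ ≠ 0` (it has an inverse). [folklore] -/
theorem theta_ne_zero (hζ : IsPrimitiveRoot ζ 9) :
    (1 - 3 * (1 - ζ) + 6 * (1 - ζ) ^ 2 - 7 * (1 - ζ) ^ 3 + 5 * (1 - ζ) ^ 4 - 2 * (1 - ζ) ^ 5) ≠ 0 := by
  intro h
  have := theta_mul_thetaInv hζ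
  rw [h, zero_mul] at this
  exact zero_ne_one this

end Generic

/-! ### §2 The field `K = ℚ₃(ζ₉)` and its ring `𝓞` of `ℤ₃`-integers: memberships -/

/-- The distinguished primitive ninth root of unity `ζ₉ = zeta 9 ℚ₃ K` of `K = CyclotomicField 9 ℚ₃` is one.
[folklore] -/
theorem zeta_spec : IsPrimitiveRoot (zeta 9 ℚ_[3] KNine) 9 := IsCyclotomicExtension.zeta_spec 9 ℚ_[3] KNine

/-- `ζ₉` is integral over `ℤ₃` (its ninth power is `1`). [folklore] -/
theorem zeta_isIntegral : IsIntegral ℤ_[3] (zeta 9 ℚ_[3] KNine) := by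
  refine IsIntegral.of_pow (by norm_num : 0 < 9) ?_
  rw [zeta_spec.pow_eq_one]
  exact isIntegral_one

/-- `ζ₉ ∈ 𝓞 = integralClosure ℤ₃ K`. [folklore] -/
theorem zeta_mem : zeta 9 ℚ_[3] KNine ∈ ONine := zeta_isIntegral

/-- Every `ℤ`-polynomial expression in `ζ₉` lies in `𝓞` (`ℤ[ζ₉] ⊆ 𝓞`). [folklore] -/
theorem aeval_zeta_mem (p : ℤ[X]) : aeval (zeta 9 ℚ_[3] KNine) p ∈ ONine := by
  induction p using Polynomial.induction_on' with
  | add p q hp hq => rw [map_add]; exact add_mem hp hq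
  | monomial n a =>
    rw [aeval_monomial, eq_intCast]
    exact mul_mem (intCast_mem ONine a) (pow_mem zeta_mem n)

/-- The uniformizer `1 − ζ₉` lies in `𝓞`. [folklore] -/
theorem one_sub_zeta_mem : 1 - zeta 9 ℚ_[3] KNine ∈ ONine := sub_mem (one_mem _) zeta_mem

/-- `θ⁻¹ = −10 − 11ζ − 7ζ² − 10ζ³ − 4ζ⁴ + 4ζ⁵ ∈ 𝓞`. [folklore] -/
theorem thetaInv_mem :
    (-10 - 11 * zeta 9 ℚ_[3] KNine - 7 * zeta 9 ℚ_[3] KNine ^ 2 - 10 * zeta 9 ℚ_[3] KNine ^ 3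
      - 4 * zeta 9 ℚ_[3] KNine ^ 4 + 4 * zeta 9 ℚ_[3] KNine ^ 5) ∈ ONine := by
  have e : (-10 - 11 * zeta 9 ℚ_[3] KNine - 7 * zeta 9 ℚ_[3] KNine ^ 2 - 10 * zeta 9 ℚ_[3] KNine ^ 3
      - 4 * zeta 9 ℚ_[3] KNine ^ 4 + 4 * zeta 9 ℚ_[3] KNine ^ 5) =
      aeval (zeta 9 ℚ_[3] KNine) (-10 - 11 * X - 7 * X ^ 2 - 10 * X ^ 3 - 4 * X ^ 4 + 4 * X ^ 5 : ℤ[X]) := by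
    simp only [map_add, map_sub, map_neg, map_mul, map_pow, aeval_X, map_ofNat]
  rw [e]; exact aeval_zeta_mem _

/-- `θ = 1 − 3ϖ + 6ϖ² − 7ϖ³ + 5ϖ⁴ − 2ϖ⁵ ∈ 𝓞` (`ϖ = 1 − ζ₉`). [folklore] -/
theorem theta_mem :
    (1 - 3 * (1 - zeta 9 ℚ_[3] KNine) + 6 * (1 - zeta 9 ℚ_[3] KNine) ^ 2 - 7 * (1 - zeta 9 ℚ_[3] KNine) ^ 3
      + 5 * (1 - zeta 9 ℚ_[3] KNine) ^ 4 - 2 * (1 - zeta 9 ℚ_[3] KNine) ^ 5) ∈ ONine := by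
  have e : (1 - 3 * (1 - zeta 9 ℚ_[3] KNine) + 6 * (1 - zeta 9 ℚ_[3] KNine) ^ 2
      - 7 * (1 - zeta 9 ℚ_[3] KNine) ^ 3 + 5 * (1 - zeta 9 ℚ_[3] KNine) ^ 4 - 2 * (1 - zeta 9 ℚ_[3] KNine) ^ 5) =
      aeval (zeta 9 ℚ_[3] KNine)
        (1 - 3 * (1 - X) + 6 * (1 - X) ^ 2 - 7 * (1 - X) ^ 3 + 5 * (1 - X) ^ 4 - 2 * (1 - X) ^ 5 : ℤ[X]) := by
    simp only [map_add, map_sub, map_mul, map_pow, aeval_X, map_ofNat, map_one]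
  rw [e]; exact aeval_zeta_mem _

/-- A `3`-adic number of norm `≤ 1`, read in `K`, lies in `𝓞` (it is a `3`-adic integer). [folklore] -/
theorem algebraMap_mem_of_norm_le_one {c : ℚ_[3]} (hc : ‖c‖ ≤ 1) : algebraMap ℚ_[3] KNine c ∈ ONine := by
  rw [show algebraMap ℚ_[3] KNine c = algebraMap ℤ_[3] KNine ⟨c, hc⟩ from
    (IsScalarTower.algebraMap_apply ℤ_[3] ℚ_[3] KNine ⟨c, hc⟩).symm]
  exact Subalgebra.algebraMap_mem _ _

/-- Numerals of `𝓞` coerce to the numerals of `K` (a `norm_cast` convenience: Mathlib has `coe_natCast` for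
subsemirings but no `ofNat` form). [folklore] -/
@[simp, norm_cast]
theorem coe_ofNat (n : ℕ) [n.AtLeastTwo] : ((ofNat(n) : ONine) : KNine) = ofNat(n) := rfl

/-! ### §3 `1/3 ∉ 𝓞`, and `1 − ζ₉` is not a unit of `𝓞` -/

/-- **`1/3 ∉ 𝓞`**: `ℤ₃` is integrally closed and `‖1/3‖₃ = 3 > 1`. [folklore] -/
theorem inv_three_not_mem : (3 : KNine)⁻¹ ∉ ONine := by
  intro h
  have h' : IsIntegral ℤ_[3] ((3 : KNine)⁻¹) := h
  have e : (3 : KNine)⁻¹ = (IsScalarTower.toAlgHom ℤ_[3] ℚ_[3] KNine) ((3 : ℚ_[3])⁻¹) := by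
    rw [IsScalarTower.coe_toAlgHom', map_inv₀, map_ofNat]
  rw [e, isIntegral_algHom_iff _ (algebraMap ℚ_[3] KNine).injective,
    IsIntegrallyClosed.isIntegral_iff] at h'
  obtain ⟨y, hy⟩ := h'
  have h1 : ‖(y : ℚ_[3])‖ ≤ 1 := y.2
  have h3 : ‖((3 : ℚ_[3]))⁻¹‖ = 3 := by
    have : ‖((3 : ℕ) : ℚ_[3])‖ = ((3 : ℕ) : ℝ)⁻¹ := Padic.norm_p (p := 3)
    rw [norm_inv]
    push_cast at this
    rw [this, inv_inv]
  have hy' : (y : ℚ_[3]) = (3 : ℚ_[3])⁻¹ := hy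
  rw [hy', h3] at h1
  norm_num at h1

/-- **`1 − ζ₉` is not a unit of `𝓞`**: `(1 − ζ₉)·y = 1` with `y ∈ 𝓞` would give `1/3 = −θ·y⁶ ∈ 𝓞`. [folklore] -/
theorem one_sub_zeta_mul_ne_one {y : KNine} (hy : y ∈ ONine) : (1 - zeta 9 ℚ_[3] KNine) * y ≠ 1 := by
  intro h
  apply inv_three_not_mem
  set ζ := zeta 9 ℚ_[3] KNine with hζdef
  have h3 := three_eq_neg_pow_six_mul_thetaInv zeta_spec
  have hθ := theta_mul_thetaInv zeta_spec
  rw [← hζdef] at h3 hθ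
  have key : (3 : KNine) *
      (-(1 - 3 * (1 - ζ) + 6 * (1 - ζ) ^ 2 - 7 * (1 - ζ) ^ 3 + 5 * (1 - ζ) ^ 4 - 2 * (1 - ζ) ^ 5) * y ^ 6) = 1 := by
    linear_combination
      (-(1 - 3 * (1 - ζ) + 6 * (1 - ζ) ^ 2 - 7 * (1 - ζ) ^ 3 + 5 * (1 - ζ) ^ 4 - 2 * (1 - ζ) ^ 5) * y ^ 6) * h3
      + ((1 - ζ) ^ 6 * y ^ 6) * hθ
      + ((((1 - ζ) * y) ^ 5 + ((1 - ζ) * y) ^ 4 + ((1 - ζ) * y) ^ 3 + ((1 - ζ) * y) ^ 2 + (1 - ζ) * y + 1)) * h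
  rw [inv_eq_of_mul_eq_one_right key]
  exact mul_mem (neg_mem theta_mem) (pow_mem hy 6)

/-! ### §4 The residue field of `𝓞` is `𝔽₃`: every element of `𝓞` is an integer plus a multiple of `1 − ζ₉` -/

/-- **One step.** For `x ∈ 𝓞` with NO residue in `𝔽₃` (no integer `a` with `x − a ∈ (1 − ζ₉)𝓞`), a relation
`c₀ + c₁·x ∈ (1 − ζ₉)𝓞` with `c₀, c₁ ∈ ℤ₃` forces `c₀, c₁ ∈ 3ℤ₃`. [folklore] -/
theorem norm_lt_one_of_residueFree {x : KNine} (hx : x ∈ ONine)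
    (H : ∀ (a : ℤ) (y : KNine), y ∈ ONine → x - a ≠ (1 - zeta 9 ℚ_[3] KNine) * y)
    {c₀ c₁ : ℚ_[3]} (h₀ : ‖c₀‖ ≤ 1) (h₁ : ‖c₁‖ ≤ 1) {Y : KNine} (hY : Y ∈ ONine)
    (h : algebraMap ℚ_[3] KNine c₀ + algebraMap ℚ_[3] KNine c₁ * x = (1 - zeta 9 ℚ_[3] KNine) * Y) :
    ‖c₀‖ < 1 ∧ ‖c₁‖ < 1 := by
  set ζ := zeta 9 ℚ_[3] KNine with hζdef
  set φ := algebraMap ℚ_[3] KNine with hφ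
  have h3 := three_eq_neg_pow_six_mul_thetaInv zeta_spec
  rw [← hζdef] at h3
  have h3φ : φ 3 = 3 := map_ofNat φ 3
  by_cases hc₁ : ‖c₁‖ < 1
  · refine ⟨?_, hc₁⟩
    -- `c₁ = 3 c₁'`, so `c₀ = (1 - ζ)·Y'` with `Y' ∈ 𝓞`
    have hc₁' := FlexTangent.norm_div_three_le_one hc₁
    have hY' : Y + (1 - ζ) ^ 5 * (-10 - 11 * ζ - 7 * ζ ^ 2 - 10 * ζ ^ 3 - 4 * ζ ^ 4 + 4 * ζ ^ 5)
        * φ (c₁ / 3) * x ∈ ONine :=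
      add_mem hY (mul_mem (mul_mem (mul_mem (pow_mem one_sub_zeta_mem 5) thetaInv_mem)
        (algebraMap_mem_of_norm_le_one hc₁')) hx)
    have e₀ : φ c₀ = (1 - ζ) * (Y + (1 - ζ) ^ 5 * (-10 - 11 * ζ - 7 * ζ ^ 2 - 10 * ζ ^ 3 - 4 * ζ ^ 4 + 4 * ζ ^ 5)
        * φ (c₁ / 3) * x) := by
      have ec : φ c₁ = 3 * φ (c₁ / 3) := by
        rw [← h3φ, ← map_mul]; congr 1; ring
      rw [ec] at h
      linear_combination h - (φ (c₁ / 3) * x) * h3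
    by_contra hc₀
    have hn : ‖c₀‖ = 1 := le_antisymm h₀ (not_lt.mp hc₀)
    have hc₀0 : c₀ ≠ 0 := by
      intro h0; rw [h0, norm_zero] at hn; exact zero_ne_one hn
    have hinv : ‖c₀⁻¹‖ ≤ 1 := by rw [norm_inv, hn, inv_one]
    apply one_sub_zeta_mul_ne_one (mul_mem hY' (algebraMap_mem_of_norm_le_one hinv))
    rw [← hζdef, ← mul_assoc, ← e₀, ← map_mul, mul_inv_cancel₀ hc₀0, map_one]
  · exfalso
    have hn : ‖c₁‖ = 1 := le_antisymm h₁ (not_lt.mp hc₁)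
    have hc₁0 : c₁ ≠ 0 := by
      intro h0; rw [h0, norm_zero] at hn; exact zero_ne_one hn
    have hinv : ‖c₁⁻¹‖ ≤ 1 := by rw [norm_inv, hn, inv_one]
    -- `x = -c₀/c₁ + (1 - ζ)·c₁⁻¹·Y`
    have hz : ‖-c₀ * c₁⁻¹‖ ≤ 1 := by
      rw [norm_mul, norm_neg]; exact mul_le_one₀ h₀ (norm_nonneg _) hinv
    obtain ⟨n, -, hnlt⟩ := Literature.IUT.LogVolume.WildCubic.exists_residue hz
    have hz' := FlexTangent.norm_div_three_le_one hnlt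
    apply H n (-((1 - ζ) ^ 5 * (-10 - 11 * ζ - 7 * ζ ^ 2 - 10 * ζ ^ 3 - 4 * ζ ^ 4 + 4 * ζ ^ 5)
        * φ ((-c₀ * c₁⁻¹ - n) / 3)) + φ c₁⁻¹ * Y)
      (add_mem (neg_mem (mul_mem (mul_mem (pow_mem one_sub_zeta_mem 5) thetaInv_mem)
        (algebraMap_mem_of_norm_le_one hz'))) (mul_mem (algebraMap_mem_of_norm_le_one hinv) hY))
    have ex : x = φ (-c₀ * c₁⁻¹) + (1 - ζ) * (φ c₁⁻¹ * Y) := by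
      have this : φ c₁⁻¹ * φ c₀ + (φ c₁⁻¹ * φ c₁) * x = φ c₁⁻¹ * ((1 - ζ) * Y) := by
        rw [← h]; ring
      have hu : φ c₁⁻¹ * φ c₁ = 1 := by rw [← map_mul, inv_mul_cancel₀ hc₁0, map_one]
      rw [map_mul, map_neg]
      linear_combination this - x * hu
    have en : φ (-c₀ * c₁⁻¹) - (n : KNine) = 3 * φ ((-c₀ * c₁⁻¹ - n) / 3) := by
      rw [← h3φ, ← map_mul, show (n : KNine) = φ n from (map_natCast φ n).symm, ← map_sub]
      congr 1; ring
    rw [Int.cast_natCast, ex, add_sub_right_comm, en]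
    linear_combination (φ ((-c₀ * c₁⁻¹ - ↑n) / 3)) * h3

end Summit.BirchSwinnertonDyer.BirchSwinnertonDyer.Theorems.NineIntegers

end
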